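import Summits.BirchSwinnertonDyer.BirchSwinnertonDyer.Theorems.ResidualThetaTransportAtTwoSignedMuSeedAtTwoPlusEvenSymplecticFreeParity
import HarnessLib

/-!
# Seed crux `SignedMuSeedAtTwoPlus` (stmt-BirchSwinnertonDyer-21438), line `ct-involution-parity`:
# calibration of the free multiplicity II — invariance under equivariant isomorphism, additivity over products

Cell `bsd-wall`, width seat `bsd-wall-rtt-p4-w2` g9 (fourth file on the line's pure algebra; parents p651662 = stub S1
`EvenSymplecticFreeParity`, p652274 = grades `k ≥ 2`, `…FreeMultSmallRank` = calibration I).  HONEST FRAMING: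
THEOREMS ONLY — no definition, no named fact, no instance, no `sorry`; pure algebra; closes no item; BSD is NOT proved.

## Why (stub S3 `OddFreeGradeFromFineMuAtTwo`)

S3 concludes `Odd (freeMult M (normElt (act γ) n) k)` for EVERY layer quotient datum `(M, act, π)`; any proof goes
through an equivariant decomposition `M ≃ (ℤ/2^k)[G_n] ⊕ C`.  The decomposition-free invariant
`m_{j+1}(A, g) = log₂ #(N(U) + U') − log₂ #U'` (`U = 2^j A ∩ A[2]`, `U' = 2^(j+1) A ∩ A[2]`, `N = ∑_{i<2^n} gⁱ`; the
stub's `freeMult A (normElt g n) (j+1)` unfolded) therefore needs: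
* `log_card_sub_log_card_eq_of_addEquiv` — **invariance** under an additive isomorphism `e : A ≃+ A'` with
  `e ∘ g = g' ∘ e`;
* `log_card_sub_log_card_prod` — **additivity**: `m_{j+1}(A₁ × A₂, G) = m_{j+1}(A₁, g₁) + m_{j+1}(A₂, g₂)` for any
  endomorphism `G` of `A₁ × A₂` acting componentwise as `(g₁, g₂)` (all four subgroups are elementary abelian
  `2`-groups, so the `log₂` are exact).
Calibration I (`…FreeMultSmallRank`) gives `m = 0` for summands of `2`-rank `< 2^n`. [folklore]
-/

noncomputable section

set_option autoImplicit false
set_option linter.dupNamespace false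

open Finset
open Literature.GroupTheory.FiniteAbelian

namespace Summit.BirchSwinnertonDyer.BirchSwinnertonDyer.Theorems.SignedMuAtTwo.EvenSymplecticFreeParity

variable {A : Type*} [AddCommGroup A]

/-! ### §0 Elementary abelian `2`-groups have order a power of `2` -/

/-- A finite subgroup of `A[2]` has order `2^d`. [folklore] -/
theorem exists_card_eq_two_pow_of_le_torsionBy [Finite A] {H : AddSubgroup A}
    (hH : H ≤ AddSubgroup.torsionBy A 2) : ∃ d : ℕ, Nat.card ↥H = 2 ^ d := by
  haveI : Fact (Nat.Prime 2) := ⟨Nat.prime_two⟩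
  have memT : ∀ y, y ∈ AddSubgroup.torsionBy A 2 ↔ (2 : ℕ) • y = 0 := fun y ↦ by
    rw [show (2 : ℤ) = ((2 : ℕ) : ℤ) from rfl]
    exact AddSubgroup.torsionBy.nsmul_iff
  letI : Module (ZMod 2) ↥H := AddCommGroup.zmodModule (fun v ↦ Subtype.ext (by
    rw [AddSubgroup.coe_nsmul, AddSubgroup.coe_zero]
    exact (memT _).mp (hH v.2)))
  exact ⟨Module.finrank (ZMod 2) ↥H, (pow_finrank_eq_natCard 2 ↥H).symm⟩

/-- Membership in `(c • id).range`. [folklore] -/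
theorem mem_range_nsmul_id_iff (c : ℕ) (x : A) : x ∈ (c • AddMonoidHom.id A).range ↔ ∃ a : A, c • a = x := by
  simp only [AddMonoidHom.mem_range, AddMonoidHom.nsmul_apply, AddMonoidHom.id_apply]

/-- An endomorphism maps subgroups of `A[2]` into `A[2]`. [folklore] -/
theorem map_le_torsionBy_two (N : A →+ A) {U : AddSubgroup A} (hU : U ≤ AddSubgroup.torsionBy A 2) :
    U.map N ≤ AddSubgroup.torsionBy A 2 := by
  refine AddSubgroup.map_le_iff_le_comap.mpr fun x hx ↦ ?_
  have h2 : (2 : ℤ) • x = 0 := (Submodule.mem_torsionBy_iff _ _).mp (hU hx)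
  change N x ∈ AddSubgroup.torsionBy A 2
  rw [AddSubgroup.torsionBy, Submodule.mem_toAddSubgroup, Submodule.mem_torsionBy_iff, ← map_zsmul, h2,
    map_zero]

/-! ### §1 Invariance under an equivariant isomorphism -/

section Iso

variable {A' : Type*} [AddCommGroup A']

/-- Equivariance iterates: `e (gⁱ x) = g'ⁱ (e x)`. [folklore] -/
theorem addEquiv_apply_pow (e : A ≃+ A') (g : AddMonoid.End A) (g' : AddMonoid.End A')
    (hge : ∀ x, e (g x) = g' (e x)) (i : ℕ) (x : A) : e ((g ^ i) x) = (g' ^ i) (e x) := by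
  induction i generalizing x with
  | zero => rw [pow_zero, pow_zero, AddMonoid.End.coe_one, AddMonoid.End.coe_one, id, id]
  | succ i ih =>
    rw [pow_succ', pow_succ', AddMonoid.End.coe_mul, AddMonoid.End.coe_mul, Function.comp_apply,
      Function.comp_apply, hge, ih]

/-- Equivariance for the norm elements: `e (N x) = N' (e x)`. [folklore] -/
theorem addEquiv_apply_normSum (e : A ≃+ A') (g : AddMonoid.End A) (g' : AddMonoid.End A')
    (hge : ∀ x, e (g x) = g' (e x)) (m : ℕ) (x : A) :
    e ((∑ i ∈ range m, (g ^ i : AddMonoid.End A)) x) = (∑ i ∈ range m, (g' ^ i : AddMonoid.End A')) (e x) := by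
  rw [normSum_apply, normSum_apply, map_sum]
  exact sum_congr rfl fun i _ ↦ addEquiv_apply_pow e g g' hge i x

/-- `e` maps `2^c A ∩ A[2]` onto `2^c A' ∩ A'[2]`. [folklore] -/
theorem map_addEquiv_range_nsmul_inf_torsionBy (e : A ≃+ A') (c : ℕ) :
    (((c • AddMonoidHom.id A).range ⊓ AddSubgroup.torsionBy A 2).map (e : A →+ A')) =
      (c • AddMonoidHom.id A').range ⊓ AddSubgroup.torsionBy A' 2 := by
  ext y
  simp only [AddSubgroup.mem_map, AddSubgroup.mem_inf, mem_range_nsmul_id_iff, AddMonoidHom.coe_coe,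
    Submodule.mem_toAddSubgroup, Submodule.mem_torsionBy_iff]
  constructor
  · rintro ⟨x, ⟨⟨a, rfl⟩, hx⟩, rfl⟩
    refine ⟨⟨e a, by rw [map_nsmul]⟩, ?_⟩
    rw [← map_zsmul, hx, map_zero]
  · rintro ⟨⟨a, rfl⟩, hy⟩
    refine ⟨c • e.symm a, ⟨⟨e.symm a, rfl⟩, ?_⟩, by rw [map_nsmul, AddEquiv.apply_symm_apply]⟩
    apply e.injective
    rw [map_zsmul, map_nsmul, AddEquiv.apply_symm_apply, hy, map_zero]

/-- **Invariance of the free multiplicity under an equivariant additive isomorphism.** If `e : A ≃+ A'`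
intertwines `g` and `g'`, then `m_{j+1}(A, g) = m_{j+1}(A', g')` (in the unfolded shape of `freeMult`). [folklore] -/
theorem log_card_sub_log_card_eq_of_addEquiv (e : A ≃+ A') (g : AddMonoid.End A)
    (g' : AddMonoid.End A') (hge : ∀ x, e (g x) = g' (e x)) (n j : ℕ) :
    Nat.log 2 (Nat.card ↥((((2 ^ j) • AddMonoidHom.id A).range ⊓ AddSubgroup.torsionBy A 2).map
        (∑ i ∈ Finset.range (2 ^ n), (g ^ i : AddMonoid.End A)) ⊔
        (((2 ^ (j + 1)) • AddMonoidHom.id A).range ⊓ AddSubgroup.torsionBy A 2))) -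
      Nat.log 2 (Nat.card ↥(((2 ^ (j + 1)) • AddMonoidHom.id A).range ⊓ AddSubgroup.torsionBy A 2)) =
    Nat.log 2 (Nat.card ↥((((2 ^ j) • AddMonoidHom.id A').range ⊓ AddSubgroup.torsionBy A' 2).map
        (∑ i ∈ Finset.range (2 ^ n), (g' ^ i : AddMonoid.End A')) ⊔
        (((2 ^ (j + 1)) • AddMonoidHom.id A').range ⊓ AddSubgroup.torsionBy A' 2))) -
      Nat.log 2 (Nat.card ↥(((2 ^ (j + 1)) • AddMonoidHom.id A').range ⊓ AddSubgroup.torsionBy A' 2)) := by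
  set N : A →+ A := ∑ i ∈ Finset.range (2 ^ n), (g ^ i : AddMonoid.End A) with hN
  set N' : A' →+ A' := ∑ i ∈ Finset.range (2 ^ n), (g' ^ i : AddMonoid.End A') with hN'
  have hNN' : ∀ x, e (N x) = N' (e x) := fun x ↦ addEquiv_apply_normSum e g g' hge _ x
  have hinj : Function.Injective (e : A →+ A') := e.injective
  have hmapN : ∀ H : AddSubgroup A, (H.map N).map (e : A →+ A') = (H.map (e : A →+ A')).map N' := by
    intro H
    rw [AddSubgroup.map_map, AddSubgroup.map_map]
    congr 1
    ext x
    exact hNN' x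
  rw [← AddSubgroup.card_map_of_injective hinj, ← AddSubgroup.card_map_of_injective
    (K := ((2 ^ (j + 1)) • AddMonoidHom.id A).range ⊓ AddSubgroup.torsionBy A 2) hinj,
    AddSubgroup.map_sup, hmapN, map_addEquiv_range_nsmul_inf_torsionBy,
    map_addEquiv_range_nsmul_inf_torsionBy]

end Iso

/-! ### §2 Additivity over products -/

section Prod

variable {A₁ A₂ : Type*} [AddCommGroup A₁] [AddCommGroup A₂]

/-- Powers of an endomorphism `G` of `A₁ × A₂` acting componentwise as `g₁ × g₂`. [folklore] -/
theorem pow_apply_of_componentwise (g₁ : AddMonoid.End A₁) (g₂ : AddMonoid.End A₂)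
    (G : AddMonoid.End (A₁ × A₂)) (hG : ∀ x, G x = ((g₁ x.1, g₂ x.2) : A₁ × A₂)) (i : ℕ) (x : A₁ × A₂) :
    (G ^ i) x = (((g₁ ^ i) x.1, (g₂ ^ i) x.2) : A₁ × A₂) := by
  induction i generalizing x with
  | zero => simp only [pow_zero, AddMonoid.End.coe_one, id]
  | succ i ih =>
    rw [pow_succ', pow_succ', pow_succ', AddMonoid.End.coe_mul, AddMonoid.End.coe_mul,
      AddMonoid.End.coe_mul, Function.comp_apply, Function.comp_apply, Function.comp_apply, ih, hG]

/-- The norm of a componentwise endomorphism is componentwise: `N_G = N₁ × N₂`. [folklore] -/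
theorem normSum_apply_of_componentwise (g₁ : AddMonoid.End A₁) (g₂ : AddMonoid.End A₂)
    (G : AddMonoid.End (A₁ × A₂)) (hG : ∀ x, G x = ((g₁ x.1, g₂ x.2) : A₁ × A₂)) (m : ℕ) (x : A₁ × A₂) :
    (∑ i ∈ range m, (G ^ i : AddMonoid.End (A₁ × A₂))) x =
      (((∑ i ∈ range m, (g₁ ^ i : AddMonoid.End A₁)) x.1,
        (∑ i ∈ range m, (g₂ ^ i : AddMonoid.End A₂)) x.2) : A₁ × A₂) := by
  rw [normSum_apply, normSum_apply, normSum_apply, Prod.ext_iff, Prod.fst_sum, Prod.snd_sum]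
  exact ⟨sum_congr rfl fun i _ ↦ by rw [pow_apply_of_componentwise g₁ g₂ G hG],
    sum_congr rfl fun i _ ↦ by rw [pow_apply_of_componentwise g₁ g₂ G hG]⟩

/-- The grade subgroups of a product are products: `2^c (A₁ × A₂) ∩ (A₁ × A₂)[2] = U(A₁) × U(A₂)`. [folklore] -/
theorem range_nsmul_inf_torsionBy_prod (c : ℕ) :
    (c • AddMonoidHom.id (A₁ × A₂)).range ⊓ AddSubgroup.torsionBy (A₁ × A₂) 2 =
      (((c • AddMonoidHom.id A₁).range ⊓ AddSubgroup.torsionBy A₁ 2).prod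
        ((c • AddMonoidHom.id A₂).range ⊓ AddSubgroup.torsionBy A₂ 2)) := by
  ext ⟨x₁, x₂⟩
  simp only [AddSubgroup.mem_inf, AddSubgroup.mem_prod, mem_range_nsmul_id_iff,
    Submodule.mem_toAddSubgroup, Submodule.mem_torsionBy_iff, Prod.smul_mk, Prod.mk_eq_zero,
    Prod.exists, Prod.mk.injEq]
  constructor
  · rintro ⟨⟨a, b, ha, hb⟩, h₁, h₂⟩
    exact ⟨⟨⟨a, ha⟩, h₁⟩, ⟨b, hb⟩, h₂⟩
  · rintro ⟨⟨⟨a, ha⟩, h₁⟩, ⟨b, hb⟩, h₂⟩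
    exact ⟨⟨a, b, ha, hb⟩, h₁, h₂⟩

/-- `(N₁ × N₂)(H₁ × H₂) = N₁(H₁) × N₂(H₂)`. [folklore] -/
theorem map_prodMap_prod (N₁ : A₁ →+ A₁) (N₂ : A₂ →+ A₂) (H₁ : AddSubgroup A₁) (H₂ : AddSubgroup A₂) :
    (H₁.prod H₂).map (AddMonoidHom.prodMap N₁ N₂) = (H₁.map N₁).prod (H₂.map N₂) := by
  ext ⟨y₁, y₂⟩
  simp only [AddSubgroup.mem_map, AddSubgroup.mem_prod, Prod.exists, AddMonoidHom.prodMap_def,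
    AddMonoidHom.prod_apply, AddMonoidHom.coe_comp, Function.comp_apply, AddMonoidHom.coe_fst,
    AddMonoidHom.coe_snd, Prod.mk.injEq]
  constructor
  · rintro ⟨a, b, ⟨ha, hb⟩, rfl, rfl⟩
    exact ⟨⟨a, ha, rfl⟩, ⟨b, hb, rfl⟩⟩
  · rintro ⟨⟨a, ha, rfl⟩, ⟨b, hb, rfl⟩⟩
    exact ⟨a, b, ⟨ha, hb⟩, rfl, rfl⟩

/-- `H₁ × H₂ ⊔ K₁ × K₂ = (H₁ ⊔ K₁) × (H₂ ⊔ K₂)` (commutative). [folklore] -/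
theorem prod_sup_prod (H₁ K₁ : AddSubgroup A₁) (H₂ K₂ : AddSubgroup A₂) :
    H₁.prod H₂ ⊔ K₁.prod K₂ = (H₁ ⊔ K₁).prod (H₂ ⊔ K₂) := by
  apply le_antisymm
  · exact sup_le (AddSubgroup.prod_mono le_sup_left le_sup_left)
      (AddSubgroup.prod_mono le_sup_right le_sup_right)
  · rintro ⟨x₁, x₂⟩ ⟨h₁, h₂⟩
    obtain ⟨a₁, ha₁, b₁, hb₁, rfl⟩ := AddSubgroup.mem_sup.mp h₁
    obtain ⟨a₂, ha₂, b₂, hb₂, rfl⟩ := AddSubgroup.mem_sup.mp h₂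
    rw [show ((a₁ + b₁, a₂ + b₂) : A₁ × A₂) = (a₁, a₂) + (b₁, b₂) from rfl]
    exact add_mem (AddSubgroup.mem_sup_left ⟨ha₁, ha₂⟩) (AddSubgroup.mem_sup_right ⟨hb₁, hb₂⟩)

/-- `#(H₁ × H₂) = #H₁ · #H₂`. [folklore] -/
theorem card_prod (H₁ : AddSubgroup A₁) (H₂ : AddSubgroup A₂) :
    Nat.card ↥(H₁.prod H₂) = Nat.card ↥H₁ * Nat.card ↥H₂ := by
  rw [Nat.card_congr (AddSubgroup.prodEquiv H₁ H₂).toEquiv, Nat.card_prod]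

/-- **Additivity of the free multiplicity over products.** For finite abelian groups `A₁, A₂` with
endomorphisms `g₁, g₂`: `m_{j+1}(A₁ × A₂, g₁ × g₂) = m_{j+1}(A₁, g₁) + m_{j+1}(A₂, g₂)` (unfolded `freeMult`;
the grade subgroups, the norm and the suprema all split over the product, and every subgroup involved is an
elementary abelian `2`-group, so the logarithms are exact). [folklore] -/
theorem log_card_sub_log_card_prod [Finite A₁] [Finite A₂] (g₁ : AddMonoid.End A₁) (g₂ : AddMonoid.End A₂)
    (G : AddMonoid.End (A₁ × A₂)) (hG : ∀ x, G x = ((g₁ x.1, g₂ x.2) : A₁ × A₂)) (n j : ℕ) :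
    Nat.log 2 (Nat.card ↥((((2 ^ j) • AddMonoidHom.id (A₁ × A₂)).range ⊓ AddSubgroup.torsionBy (A₁ × A₂) 2).map
        (∑ i ∈ Finset.range (2 ^ n), (G ^ i : AddMonoid.End (A₁ × A₂))) ⊔
        (((2 ^ (j + 1)) • AddMonoidHom.id (A₁ × A₂)).range ⊓ AddSubgroup.torsionBy (A₁ × A₂) 2))) -
      Nat.log 2 (Nat.card ↥(((2 ^ (j + 1)) • AddMonoidHom.id (A₁ × A₂)).range ⊓
        AddSubgroup.torsionBy (A₁ × A₂) 2)) =
    (Nat.log 2 (Nat.card ↥((((2 ^ j) • AddMonoidHom.id A₁).range ⊓ AddSubgroup.torsionBy A₁ 2).map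
        (∑ i ∈ Finset.range (2 ^ n), (g₁ ^ i : AddMonoid.End A₁)) ⊔
        (((2 ^ (j + 1)) • AddMonoidHom.id A₁).range ⊓ AddSubgroup.torsionBy A₁ 2))) -
      Nat.log 2 (Nat.card ↥(((2 ^ (j + 1)) • AddMonoidHom.id A₁).range ⊓ AddSubgroup.torsionBy A₁ 2))) +
    (Nat.log 2 (Nat.card ↥((((2 ^ j) • AddMonoidHom.id A₂).range ⊓ AddSubgroup.torsionBy A₂ 2).map
        (∑ i ∈ Finset.range (2 ^ n), (g₂ ^ i : AddMonoid.End A₂)) ⊔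
        (((2 ^ (j + 1)) • AddMonoidHom.id A₂).range ⊓ AddSubgroup.torsionBy A₂ 2))) -
      Nat.log 2 (Nat.card ↥(((2 ^ (j + 1)) • AddMonoidHom.id A₂).range ⊓ AddSubgroup.torsionBy A₂ 2))) := by
  -- notation
  set N : A₁ × A₂ →+ A₁ × A₂ := ∑ i ∈ Finset.range (2 ^ n), (G ^ i : AddMonoid.End (A₁ × A₂)) with hN
  set N₁ : A₁ →+ A₁ := ∑ i ∈ Finset.range (2 ^ n), (g₁ ^ i : AddMonoid.End A₁) with hN₁
  set N₂ : A₂ →+ A₂ := ∑ i ∈ Finset.range (2 ^ n), (g₂ ^ i : AddMonoid.End A₂) with hN₂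
  set U₁ := ((2 ^ j) • AddMonoidHom.id A₁).range ⊓ AddSubgroup.torsionBy A₁ 2 with hU₁
  set U₁' := ((2 ^ (j + 1)) • AddMonoidHom.id A₁).range ⊓ AddSubgroup.torsionBy A₁ 2 with hU₁'
  set U₂ := ((2 ^ j) • AddMonoidHom.id A₂).range ⊓ AddSubgroup.torsionBy A₂ 2 with hU₂
  set U₂' := ((2 ^ (j + 1)) • AddMonoidHom.id A₂).range ⊓ AddSubgroup.torsionBy A₂ 2 with hU₂'
  have hNx : ∀ x, N x = ((N₁ x.1, N₂ x.2) : A₁ × A₂) := fun x ↦ normSum_apply_of_componentwise g₁ g₂ G hG _ x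
  have hNeq : N = AddMonoidHom.prodMap N₁ N₂ := by
    ext x
    · rw [hNx]; rfl
    · rw [hNx]; rfl
  -- the product splits
  rw [range_nsmul_inf_torsionBy_prod, range_nsmul_inf_torsionBy_prod, hNeq, map_prodMap_prod, prod_sup_prod,
    card_prod, card_prod]
  -- all cardinalities are powers of two
  obtain ⟨a₁, ha₁⟩ := exists_card_eq_two_pow_of_le_torsionBy (A := A₁) (H := U₁.map N₁ ⊔ U₁')
    (sup_le (map_le_torsionBy_two N₁ inf_le_right) inf_le_right)
  obtain ⟨b₁, hb₁⟩ := exists_card_eq_two_pow_of_le_torsionBy (A := A₁) (H := U₁') inf_le_right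
  obtain ⟨a₂, ha₂⟩ := exists_card_eq_two_pow_of_le_torsionBy (A := A₂) (H := U₂.map N₂ ⊔ U₂')
    (sup_le (map_le_torsionBy_two N₂ inf_le_right) inf_le_right)
  obtain ⟨b₂, hb₂⟩ := exists_card_eq_two_pow_of_le_torsionBy (A := A₂) (H := U₂') inf_le_right
  -- and `#U' ≤ #(N(U) + U')`
  have hle₁ : b₁ ≤ a₁ := by
    have h := Nat.card_le_card_of_injective _ (AddSubgroup.inclusion_injective
      (le_sup_right : U₁' ≤ U₁.map N₁ ⊔ U₁'))
    rw [ha₁, hb₁] at h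
    exact (Nat.pow_le_pow_iff_right Nat.one_lt_two).mp h
  have hle₂ : b₂ ≤ a₂ := by
    have h := Nat.card_le_card_of_injective _ (AddSubgroup.inclusion_injective
      (le_sup_right : U₂' ≤ U₂.map N₂ ⊔ U₂'))
    rw [ha₂, hb₂] at h
    exact (Nat.pow_le_pow_iff_right Nat.one_lt_two).mp h
  rw [ha₁, hb₁, ha₂, hb₂, ← pow_add, ← pow_add, Nat.log_pow Nat.one_lt_two, Nat.log_pow Nat.one_lt_two,
    Nat.log_pow Nat.one_lt_two, Nat.log_pow Nat.one_lt_two, Nat.log_pow Nat.one_lt_two,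
    Nat.log_pow Nat.one_lt_two]
  omega

end Prod

end Summit.BirchSwinnertonDyer.BirchSwinnertonDyer.Theorems.SignedMuAtTwo.EvenSymplecticFreeParity

end
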